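import Summits.QuantumFields.YangMills.Theorems.UnitScaleTiltProp7FrameRem2RowZeroT3
import Summits.QuantumFields.YangMills.Theorems.UnitScaleTiltProp7TrueLinIterHasDeriv
import Summits.QuantumFields.YangMills.Theorems.UnitScaleTiltProp7JointRowTowerData
import Summits.QuantumFields.YangMills.Theorems.UnitScaleTiltProp7CompetitorGuardOfLevelSups
import Summits.QuantumFields.YangMills.Theorems.UnitScaleTiltProp7TwistedLevelMassOfRegPr
import HarnessLib

/-!
# Route `UnitScaleTilt`, crux K1 «MinimiserStabilityRegPr» (stmt-QuantumFields-19200), route-R (β) R0 REM2ˢ, row «(n3)₂-sym» = H2-1ˢ, file N6s —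
# THE LINEAR LETTER SEAM: the displayed linear part `D[Ū⁽ˡ⁾(e^{·}·W♭)(b)](0)(iX)·(Ūˡ[W] b)⋆` of px16 G3-s's `hN2s` ∕ px13 F-γ3b's `hR` IS the true linearised iterate
# `Q l (iX) b` of the plain symmetric tower at the background `W`, at EVERY level `l ≤ K − n` (the level-0 case is ✓p706552 `fderiv_emlIterU_zero_mul_star_eq`)

Cell `ym3-torus` (HUMAN RULING D-0037: YM₃ on the three-torus is ladder rung R3 — not d = 4, not infinite volume, not a mass gap, not Clay), width seat `ym3-torus-px21` (gen 7),
pen of the «(n3)₂-sym» supplier (px13 g6 «GO» 2026-08-29 07:50Z).  THEOREMS ONLY (0 `def`, 0 `sorry`); `--supports stmt-QuantumFields-19200 --as helper`, count-neutral.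
Nothing here claims the «(n3)₂-sym» row, (β), the stub, the crux, d = 4 or the mass gap.

THE POINT.  The supplier's engine (✓p708624 sparse two-channel engine, N6a `Prop7N32SymSparseRow`) bounds `Σ_b‖Y_l(b) − Q l X′ b‖` for the true-linearised iterate family `Q`
(✓`Prop7CurvedLandauRowA.exists_trueLinIter_family`, letters of ✓`Prop7FibreTrueLinDefect`), whereas the displayed row reads the Fréchet derivative of the UNITS tower
`t ↦ ↑(emlIterU l (fun b′ ↦ expUnit (t b′) * bgUnits F K W b′) b)` at `t = 0` in the direction `iX`, times `(Ūˡ[W] b)⋆`.  The two agree: along the real curve `s ↦ s•(iX)` the units tower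
is the plain `SU(2)` tower of `e^{isX}·W` (✓`Prop7CompetitorGuardOfLevelSups.coe_emlIterU_unitsField_competitor_T3`, guards from ✓`Prop7JointRowTowerData.chartSups`∕`supNumerals` at
`‖sX_b‖ ≤ s₀` for `|s| ≤ 1`), whose ratio against `Ūˡ[W]` has derivative `Q l (iX) b` at `s = 0` (✓`Prop7TrueLinIterHasDeriv.hasDerivAt_iter_ratio`, loop guards of the background tower
✓`loop_size_background_T3`); the units tower is ℂ-differentiable at `0` (★routeR-w2 ✓p703891 `differentiableAt_coe_emlIterU_of_regPr`), so its directional derivative along the curve is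
`fderiv … (iX)`; uniqueness of real derivatives closes the seam.

WHAT IS PROVED (ns `…Theorems.Prop7N32SymLinearLetterT3`; the T³ member, `SU(2)`).
* §1 `hasDerivAt_real_smul` ∕ `hasDerivAt_exp_real_smul` — `s ↦ s•v`, `s ↦ exp(s•B)` at `s = 0` (real parameter, complex Banach algebra).
* §2 `isHermitian_trace_real_smul`, `emb15_expHermField_zero_smul`, `coe_emb15_expHermField_real_smul` — the competitor curve `Γ s := e^{isX}·W` (Hermitian data, `Γ 0 = W`, bond values).
* §3 ★★ `fderiv_emlIterU_mul_star_eq_trueLinIter_of_regPr` — for `RegPr F n K e W` (`0 < e`, `10¹⁴L⁹e ≤ 1`), `X` Hermitian traceless with `‖X b‖ ≤ s₀`, `0 ≤ s₀`, `4s₀ ≤ 1`,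
  `4·10¹¹L⁹·(ℓ·s₀) ≤ 1`, and `Q` the true-linearised iterate family at `W`:  for every `l ≤ K − n` and level-`l` bond `b`,
  `fderiv ℂ (t ↦ ↑(emlIterU l (fun b′ ↦ expUnit (t b′) * bgUnits F K W b′) b)) 0 (fun b′ ↦ I•X b′) * (Ūˡ[W] b)⋆ = Q l (fun b′ ↦ I•X b′) b`.
HONEST SCOPE.  Calculus bookkeeping over landed bricks; no estimate; nothing of `hN2s`, (β), the stub or the crux is advanced analytically here.
References: T. Bałaban, CMP 98 (1985) 17–51 [Balaban1985Averaging] ((11) p.19, Prop. 3 (122)–(125) p.36); CMP 109 (1987) 249–301 [Balaban1987RG1] ((0.4), (0.11) p.253);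
CMP 102 (1985) 277–309 [Balaban1985Variational] ((15) p.280, (19) p.281).
-/

set_option autoImplicit false

noncomputable section

open scoped BigOperators Matrix.Norms.L2Operator Topology
open NormedSpace

namespace Summit.QuantumFields.YangMills.Theorems.Prop7N32SymLinearLetterT3

open Literature.MathematicalPhysics.QuantumFieldTheory.Balaban1983to89
open Literature.MathematicalPhysics.QuantumFieldTheory.Balaban1983to89.T3ContinuumYM3Torus
open Literature.MathematicalPhysics.QuantumFieldTheory.Balaban1983to89.T3PrintedRegularMinimiser (RegPr)
open Finset T4Continuum BlockAveraging AveragingRT ExpMeanLog BlockAveragingEMLLinearised BlockAveragingEMLLinearisedBackground BlockAveragingEMLProp2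
open B7Prop1Explicit (expUnit val_expUnit)
open B10Eq27TorusAxialLog (unitsField toUField)
open T3SectALandauChart (emb15 bgUnits)
open Summit.QuantumFields.YangMills.Theorems.Prop8Chart (emlIterU)
open Summit.QuantumFields.YangMills.Theorems.Prop7TPrint (expHermField expHermField_zero)
open Summit.QuantumFields.YangMills.Theorems.Prop7FrameRem2RowZeroT3 (coe_emb15_expHermField_apply)
open Summit.QuantumFields.YangMills.Theorems.Prop7Chart48SymUntwisted (unitsField_toUField_emb15_expHermField)
open Summit.QuantumFields.YangMills.Theorems.Prop7SymFrameLinearResponseOfRegPr (differentiableAt_coe_emlIterU_of_regPr)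
open Summit.QuantumFields.YangMills.Theorems.Prop7TrueLinIterHasDeriv (hasDerivAt_iter_ratio)
open Summit.QuantumFields.YangMills.Theorems.Prop7JointRowTowerData (chartSups supNumerals)
open Summit.QuantumFields.YangMills.Theorems.Prop7CompetitorGuardOfLevelSups (coe_emlIterU_unitsField_competitor_T3 loop_size_background_T3)
open Summit.QuantumFields.YangMills.Theorems.Prop7TwistedLevelMassOfRegPr (plaq_le_of_regPr window_weak)
open Summit.QuantumFields.YangMills.Theorems.Prop7HolRatioPerStep (coe_mul_star_self)

/-! ## §1 Real-parameter derivatives at `0` in a complex Banach space ∕ algebra -/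

/-- `s ↦ s • v` (real `s`) has derivative `v` at `0`. [folklore] -/
theorem hasDerivAt_real_smul {E : Type*} [NormedAddCommGroup E] [NormedSpace ℝ E] (v : E) :
    HasDerivAt (fun s : ℝ => s • v) v 0 := by
  simpa using (hasDerivAt_id (0 : ℝ)).smul_const v

/-- `s ↦ exp(s • B)` (real `s`, `B` in a complete normed ℂ-algebra) has derivative `B` at `0`. [folklore] -/
theorem hasDerivAt_exp_real_smul {𝔸 : Type*} [NormedRing 𝔸] [NormedAlgebra ℂ 𝔸] [CompleteSpace 𝔸] (B : 𝔸) :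
    HasDerivAt (fun s : ℝ => exp (s • B)) B 0 := by
  have h1 : HasDerivAt (fun s : ℝ => s • B) B 0 := hasDerivAt_real_smul B
  have h2 : HasFDerivAt (exp : 𝔸 → 𝔸) ((1 : 𝔸 →L[ℂ] 𝔸).restrictScalars ℝ) ((fun s : ℝ => s • B) 0) := by
    simp only [zero_smul]
    exact (hasFDerivAt_exp_zero (𝕂 := ℂ) (𝔸 := 𝔸)).restrictScalars ℝ
  have h := h2.comp_hasDerivAt (0 : ℝ) h1
  simpa [Function.comp_def] using h

/-! ## §2 The competitor curve `Γ s := e^{isX}·W` -/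

section T3

variable (F : T3Family) (n K : ℕ)

/-- For real `s`, `s•X` is again Hermitian and traceless bondwise. [folklore] -/
theorem isHermitian_trace_real_smul (X : PBond (F.P K) 0 → Matrix (Fin 2) (Fin 2) ℂ)
    (hX : ∀ b : PBond (F.P K) 0, (X b).IsHermitian ∧ Matrix.trace (X b) = 0) (s : ℝ) :
    ∀ b : PBond (F.P K) 0, ((s • X) b).IsHermitian ∧ Matrix.trace ((s • X) b) = 0 := by
  intro b
  refine ⟨?_, ?_⟩
  · show IsSelfAdjoint (s • X b)
    exact IsSelfAdjoint.smul (IsSelfAdjoint.all s) (show IsSelfAdjoint (X b) from (hX b).1)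
  · show Matrix.trace (s • X b) = 0
    rw [Matrix.trace_smul, (hX b).2, smul_zero]

/-- `Γ 0 = W`: `e^{i·0}·W = W`. [cite: Balaban1985Variational, (15) p.280] -/
theorem emb15_expHermField_zero_smul (W : GaugeField (F.P K) 0 (Matrix.specialUnitaryGroup (Fin 2) ℂ)) (X : PBond (F.P K) 0 → Matrix (Fin 2) (Fin 2) ℂ) :
    emb15 W (expHermField ((0 : ℝ) • X)) = W := by
  have h0 : ((0 : ℝ) • X) = fun _ : PBond (F.P K) 0 => (0 : Matrix (Fin 2) (Fin 2) ℂ) := by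
    funext b; simp
  rw [h0, expHermField_zero]
  funext b
  simp [emb15]
  rfl

/-- Bond values along the curve: `↑(Γ s b)·(W b)⋆ = exp(s•(iX_b))`. [cite: Balaban1985Variational, (15) p.280, (19) p.281] -/
theorem coe_emb15_expHermField_real_smul_mul_star (W : GaugeField (F.P K) 0 (Matrix.specialUnitaryGroup (Fin 2) ℂ))
    (X : PBond (F.P K) 0 → Matrix (Fin 2) (Fin 2) ℂ) (hX : ∀ b : PBond (F.P K) 0, (X b).IsHermitian ∧ Matrix.trace (X b) = 0) (s : ℝ) (b : PBond (F.P K) 0) :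
    ((emb15 W (expHermField (s • X)) b : Matrix.specialUnitaryGroup (Fin 2) ℂ) : Matrix (Fin 2) (Fin 2) ℂ)
        * star ((W b : Matrix.specialUnitaryGroup (Fin 2) ℂ) : Matrix (Fin 2) (Fin 2) ℂ)
      = exp (s • (Complex.I • X b)) := by
  rw [coe_emb15_expHermField_apply F W (s • X) (isHermitian_trace_real_smul F K X hX s) b, mul_assoc, coe_mul_star_self, mul_one]
  congr 1
  show Complex.I • (s • X b) = s • (Complex.I • X b)
  rw [smul_comm]

/-! ## §3 ★★ The seam -/

/-- ★★ **THE DISPLAYED LINEAR LETTER IS THE TRUE LINEARISED ITERATE.**  `W ∈ 𝔘_k(e)` (`RegPr F n K e W`, `0 < e`, `10¹⁴L⁹e ≤ 1`); `X` Hermitian traceless with `‖X b‖ ≤ s₀`,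
`0 ≤ s₀`, `4s₀ ≤ 1`, `4·10¹¹L⁹·(ℓ·s₀) ≤ 1` (the chart windows of ✓`chartSups`∕`supNumerals`); `Q` ANY recursion family of the true one-step linearisations along the tower of `W`
(`hQ0`, `hQs`).  Then for every `l ≤ K − n` and every level-`l` bond `b`:
`fderiv ℂ (t ↦ ↑(emlIterU l (fun b′ ↦ expUnit (t b′) * bgUnits F K W b′) b)) 0 (fun b′ ↦ I•X b′) * (Ūˡ[W] b)⋆ = Q l (fun b′ ↦ I•X b′) b`.
[cite: Balaban1985Averaging, (11) p.19, Prop. 3 (122)-(125) p.36; Balaban1987RG1, (0.4) p.253, (0.11) p.253; Balaban1985Variational, (15) p.280] -/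
theorem fderiv_emlIterU_mul_star_eq_trueLinIter_of_regPr {e s₀ : ℝ} (he : 0 < e) (heL : 100000000000000 * (F.L : ℝ) ^ 9 * e ≤ 1)
    (hs0 : 0 ≤ s₀) (hs4 : 4 * s₀ ≤ 1) (hsL : 400000000000 * (F.L : ℝ) ^ 9 * (((F.L : ℝ) ^ (K - n)) * s₀) ≤ 1)
    (W : GaugeField (F.P K) 0 (Matrix.specialUnitaryGroup (Fin 2) ℂ)) (hreg : RegPr F n K e W)
    (X : PBond (F.P K) 0 → Matrix (Fin 2) (Fin 2) ℂ) (hX : ∀ b : PBond (F.P K) 0, (X b).IsHermitian ∧ Matrix.trace (X b) = 0)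
    (hsX : ∀ b : PBond (F.P K) 0, ‖X b‖ ≤ s₀)
    (Q : (k : ℕ) → (PBond (F.P K) 0 → Matrix (Fin 2) (Fin 2) ℂ) → PBond (F.P K) k → Matrix (Fin 2) (Fin 2) ℂ) (hQ0 : ∀ Y, Q 0 Y = Y)
    (hQs : ∀ (k : ℕ) (Y : PBond (F.P K) 0 → Matrix (Fin 2) (Fin 2) ℂ) (c : PBond (F.P K) (k + 1)), Q (k + 1) Y c = (fderiv ℂ (eml : (Idx (F.P K) → Matrix (Fin 2) (Fin 2) ℂ) → Matrix (Fin 2) (Fin 2) ℂ)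
            (fun i => ((loopHol (Averaging.iter (fun i => blockAvg (P := F.P K) (j := i) (expMeanLogSU (n := Fin 2))) k W) c i : Matrix.specialUnitaryGroup (Fin 2) ℂ) : Matrix (Fin 2) (Fin 2) ℂ))
            (fun i => covWalkSum (Averaging.iter (fun i => blockAvg (P := F.P K) (j := i) (expMeanLogSU (n := Fin 2))) k W) (Q k Y) (walk (emb c.src) (loopWord (F.P K).L c.dir (off i.1) i.2.1 i.2.2))
              * ((loopHol (Averaging.iter (fun i => blockAvg (P := F.P K) (j := i) (expMeanLogSU (n := Fin 2))) k W) c i : Matrix.specialUnitaryGroup (Fin 2) ℂ) : Matrix (Fin 2) (Fin 2) ℂ))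
            * star ((corr (expMeanLogSU (n := Fin 2)) (Averaging.iter (fun i => blockAvg (P := F.P K) (j := i) (expMeanLogSU (n := Fin 2))) k W) c : Matrix.specialUnitaryGroup (Fin 2) ℂ) : Matrix (Fin 2) (Fin 2) ℂ)
          + ((corr (expMeanLogSU (n := Fin 2)) (Averaging.iter (fun i => blockAvg (P := F.P K) (j := i) (expMeanLogSU (n := Fin 2))) k W) c : Matrix.specialUnitaryGroup (Fin 2) ℂ) : Matrix (Fin 2) (Fin 2) ℂ)
            * covWalkSum (Averaging.iter (fun i => blockAvg (P := F.P K) (j := i) (expMeanLogSU (n := Fin 2))) k W) (Q k Y) (walk (emb c.src) (List.replicate (F.P K).L (c.dir, true)))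
            * star ((corr (expMeanLogSU (n := Fin 2)) (Averaging.iter (fun i => blockAvg (P := F.P K) (j := i) (expMeanLogSU (n := Fin 2))) k W) c : Matrix.specialUnitaryGroup (Fin 2) ℂ) : Matrix (Fin 2) (Fin 2) ℂ))) :
    ∀ l, l ≤ K - n → ∀ b : PBond (F.P K) l,
      fderiv ℂ (fun t : PBond (F.P K) 0 → Matrix (Fin 2) (Fin 2) ℂ =>
          ((emlIterU l (fun b' => expUnit (t b') * bgUnits F K W b') b : (Matrix (Fin 2) (Fin 2) ℂ)ˣ) : Matrix (Fin 2) (Fin 2) ℂ)) 0 (fun b' => Complex.I • X b')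
        * star ((Averaging.iter (fun i => blockAvg (P := F.P K) (j := i) (expMeanLogSU (n := Fin 2))) l W b : Matrix.specialUnitaryGroup (Fin 2) ℂ) : Matrix (Fin 2) (Fin 2) ℂ)
      = Q l (fun b' => Complex.I • X b') b := by
  intro l hl b
  have hL3 : (3 : ℝ) ≤ (F.L : ℝ) := Summit.QuantumFields.YangMills.Theorems.Prop7CurvedLandauKnitT3.three_le_L F
  have hL1 : (1 : ℝ) ≤ (F.L : ℝ) := by linarith
  have heL' : 1000000 * (F.L : ℝ) ^ 5 * e ≤ 1 := window_weak F he heL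
  have he12 : 10 ^ 12 * (F.L : ℝ) ^ 3 * e ≤ 1 := by
    have h9 : (F.L : ℝ) ^ 3 ≤ (F.L : ℝ) ^ 9 := pow_le_pow_right₀ hL1 (by norm_num)
    have h3 : 0 ≤ (F.L : ℝ) ^ 3 := by positivity
    nlinarith [heL, h9, he.le, mul_nonneg h3 he.le]
  have hUe := plaq_le_of_regPr F n K hreg
  -- letters
  set v : PBond (F.P K) 0 → Matrix (Fin 2) (Fin 2) ℂ := fun b' => Complex.I • X b' with hv
  set Fb : (PBond (F.P K) 0 → Matrix (Fin 2) (Fin 2) ℂ) → Matrix (Fin 2) (Fin 2) ℂ := fun t =>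
      ((emlIterU l (fun b' => expUnit (t b') * bgUnits F K W b') b : (Matrix (Fin 2) (Fin 2) ℂ)ˣ) : Matrix (Fin 2) (Fin 2) ℂ) with hFb
  set cW : Matrix (Fin 2) (Fin 2) ℂ :=
      star ((Averaging.iter (fun i => blockAvg (P := F.P K) (j := i) (expMeanLogSU (n := Fin 2))) l W b : Matrix.specialUnitaryGroup (Fin 2) ℂ) : Matrix (Fin 2) (Fin 2) ℂ) with hcW
  set Γ : ℝ → GaugeField (F.P K) 0 (Matrix.specialUnitaryGroup (Fin 2) ℂ) := fun s => emb15 W (expHermField (s • X)) with hΓ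
  -- (A) the units tower along the real curve `s ↦ s • v`
  have hdiff : DifferentiableAt ℂ Fb 0 := differentiableAt_coe_emlIterU_of_regPr he he12 W hreg hl b
  have hγ : HasDerivAt (fun s : ℝ => s • v) v 0 := hasDerivAt_real_smul v
  have hcomp : HasDerivAt (fun s : ℝ => Fb (s • v)) (fderiv ℂ Fb 0 v) 0 := by
    have h1 : HasFDerivAt Fb ((fderiv ℂ Fb 0).restrictScalars ℝ) ((fun s : ℝ => s • v) 0) := by
      simp only [zero_smul]
      exact hdiff.hasFDerivAt.restrictScalars ℝ
    have h := h1.comp_hasDerivAt (0 : ℝ) hγ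
    simpa [Function.comp_def] using h
  have hA1 : HasDerivAt (fun s : ℝ => Fb (s • v) * cW) (fderiv ℂ Fb 0 v * cW) 0 := hcomp.mul_const cW
  -- (B) the `SU(2)` tower along `Γ` (✓`hasDerivAt_iter_ratio`)
  have hΓ0 : Γ 0 = W := emb15_expHermField_zero_smul F K W X
  have hAb : ∀ b' : PBond (F.P K) 0, HasDerivAt (fun s : ℝ =>
      ((Γ s b' : Matrix.specialUnitaryGroup (Fin 2) ℂ) : Matrix (Fin 2) (Fin 2) ℂ) * star ((W b' : Matrix.specialUnitaryGroup (Fin 2) ℂ) : Matrix (Fin 2) (Fin 2) ℂ)) (v b') 0 := by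
    intro b'
    have hfun : (fun s : ℝ => ((Γ s b' : Matrix.specialUnitaryGroup (Fin 2) ℂ) : Matrix (Fin 2) (Fin 2) ℂ) * star ((W b' : Matrix.specialUnitaryGroup (Fin 2) ℂ) : Matrix (Fin 2) (Fin 2) ℂ))
        = fun s : ℝ => exp (s • (Complex.I • X b')) := by
      funext s; exact coe_emb15_expHermField_real_smul_mul_star F K W X hX s b'
    rw [hfun]
    exact hasDerivAt_exp_real_smul (Complex.I • X b')
  have hloop := loop_size_background_T3 F n K W he heL' hUe
  have hδ : deltaSU (Fin 2) = 1 / 3 := by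
    unfold deltaSU
    rw [Fintype.card_fin]
    refine min_eq_left ?_
    rw [le_div_iff₀ (by norm_num)]
    have := Real.pi_gt_three; push_cast; linarith
  have hA2 : HasDerivAt (fun s : ℝ =>
      ((Averaging.iter (fun i => blockAvg (P := F.P K) (j := i) (expMeanLogSU (n := Fin 2))) l (Γ s) b : Matrix.specialUnitaryGroup (Fin 2) ℂ) : Matrix (Fin 2) (Fin 2) ℂ) * cW)
      (Q l v b) 0 :=
    hasDerivAt_iter_ratio W Γ hΓ0 v hAb Q hQ0 hQs (fun _ => 1 / 24) l
      (fun j hj c i => (hloop j (lt_of_lt_of_le hj hl) c i).1.trans (hloop j (lt_of_lt_of_le hj hl) c i).2)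
      (fun j _ => le_rfl) (fun j _ => by rw [hδ]; norm_num) b
  -- (C) the two towers agree along the curve for `|s| ≤ 1`
  have hagree : ∀ s : ℝ, |s| ≤ 1 → Fb (s • v)
      = ((Averaging.iter (fun i => blockAvg (P := F.P K) (j := i) (expMeanLogSU (n := Fin 2))) l (Γ s) b : Matrix.specialUnitaryGroup (Fin 2) ℂ) : Matrix (Fin 2) (Fin 2) ℂ) := by
    intro s hs1
    have hXs : ∀ b' : PBond (F.P K) 0, ‖(s • X) b'‖ ≤ s₀ := fun b' => by
      rw [Pi.smul_apply, norm_smul, Real.norm_eq_abs]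
      calc |s| * ‖X b'‖ ≤ 1 * ‖X b'‖ := mul_le_mul_of_nonneg_right hs1 (norm_nonneg _)
        _ ≤ s₀ := by rw [one_mul]; exact hsX b'
    have hDs := isHermitian_trace_real_smul F K X hX s
    obtain ⟨-, hμ⟩ := chartSups F n K he heL hs0 hs4 hsL hreg (s • X) hDs hXs
    obtain ⟨-, hμ0, hμ72, hμN, -⟩ := supNumerals F n K hs0 hsL
    have hbridge := coe_emlIterU_unitsField_competitor_T3 F n K W (Γ s) he heL' hUe
      (fun j : ℕ => 480 * (F.L : ℝ) ^ 4 * (F.L : ℝ) ^ j * s₀) hμ0 hμ hμ72 hμN l hl b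
    rw [← hbridge]
    have hunits : unitsField (toUField (Γ s)) = fun b' => expUnit ((s • v) b') * bgUnits F K W b' := by
      rw [hΓ]
      simp only
      rw [unitsField_toUField_emb15_expHermField (F := F) (K := K) W (s • X) hDs]
      funext b'
      congr 2
      show Complex.I • (s • X) b' = (s • v) b'
      simp only [hv, Pi.smul_apply, smul_comm s Complex.I (X b')]
    simp only [hFb, hunits]
  have hev : (fun s : ℝ => Fb (s • v) * cW) =ᶠ[𝓝 0] (fun s : ℝ =>
      ((Averaging.iter (fun i => blockAvg (P := F.P K) (j := i) (expMeanLogSU (n := Fin 2))) l (Γ s) b : Matrix.specialUnitaryGroup (Fin 2) ℂ) : Matrix (Fin 2) (Fin 2) ℂ) * cW) := by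
    have hball : Metric.closedBall (0 : ℝ) 1 ∈ 𝓝 (0 : ℝ) := Metric.closedBall_mem_nhds 0 zero_lt_one
    filter_upwards [hball] with s hs
    rw [Metric.mem_closedBall, dist_zero_right, Real.norm_eq_abs] at hs
    rw [hagree s hs]
  -- (D) uniqueness of the derivative
  have hA1' := hA1.congr_of_eventuallyEq hev.symm
  exact hA1'.unique hA2

end T3

end Summit.QuantumFields.YangMills.Theorems.Prop7N32SymLinearLetterT3

end
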